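/-
Copyright (c) 2026 the pub-hodgecm-mathlib formalisation cell (harness21).  Prover seat hodgecm-mathlib-K2Liu-p09 (g3): Track B «K2-LIT», #184♮ = hLiu418,
payer-internal organ O3b-inert «INERT LOCAL IDENTITY (E)_v» of file #34 `Theorems/K2LiuDoublingZetaGL1.lean` (LEAD F0P6-plan (g10) DEAL K2/STATUS
2026-09-04T02:36:29Z; REPORT-FIRST #34 v3, K2/K2Liu-p09/g3; DEPMAP v2.7 §13 `hInert` FEED TABLE row «(E)_v»).
-/
import Summits.HodgeConjecture.HodgeConjecture.Theorems.K2LiuUnramifiedDoublingHeckeIdentityInert   -- ★ #28i (p857283)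
import Summits.HodgeConjecture.HodgeConjecture.Theorems.K2LiuDoublingZetaGL1SplitIdentity            -- ★ O3b (p857373): generic transport §1, the split row
import HarnessLib

/-!
# Crux `HLiu418`, Track B road `K2_Liu`, file #34 — organ O3b-inert «THE LOCAL DOUBLING-HECKE IDENTITY (E)_v AT AN INERT GOOD PLACE, FOR AN
# AUTOMORPHIC VECTOR OF `U(H)`»

Cell `hodgecm-mathlib`, crux item hLiu418 = `stmt-HodgeConjecture-24832`, route of record `HCCMUnconditional`; squad K2 ∕ K2Liu, prover K2Liu-p09 (g3).
THEOREMS ONLY (no `def`, no instance, no notation, no named-fact hypothesis, no `sorry`); lane `--supports stmt-HodgeConjecture-24832 --as helper`.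

The inert twin of ★ O3b `K2LiuDoublingZetaGL1SplitIdentity.localIdentity_split`: ★ #28i `unramifiedDoublingHeckeIdentityInert` (one Hecke generator `t₁`,
inert frame `ϖ, T`) is stated on the `U(diag dV)(L⁺_v)` side for a Banach representation; s23's automorphic `P` lives on `U(H)`, docked by
`β_v := localCongr g⁻¹ : U(H)(L⁺_v) ≃ₜ* U(diag dV)(L⁺_v)`.  This file transports exactly as ★ O3b does (its generic §1 `measure_map_eq_of_preimage`,
`isDoublingHeckeEigenvector_pull`, here `isSphericalHeckeEigen_push₁` for ONE generator), applies ★ #28i to the action `y ↦ π_P(ι_v(β_v⁻¹ y))`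
(contractive ★ `norm_rightRegular_apply`, strongly continuous ★ `isStronglyContinuous_rightRegular_holds`), and reads the operator identity on matrix
coefficients (★ `K2LiuDoublingZetaGL1LocalScalar.localScalar_of_isDoublingHeckeEigenvector`):
* `localIdentity_inert`: hypothesis (E) of ★ #29s at an inert good `v ∉ S` for `Λ_v := Λ_{s,v} ∘ ι_v(·,1) ∘ β_v`, with ★ #28i's cleared closed form for
  `c_v` at the spherical eigenvalue `a₁` (in #34: `a₁ = a₁(v)` of socket #24i, whence ★ O5-inert `inertPlace_H` gives (H)_v).

HONEST LABEL: HC_CM is proved only modulo the printed citations (2 remaining named inputs: hLiu418 = stmt-HodgeConjecture-24832,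
h413 = stmt-HodgeConjecture-24833) until rung 0 closes; this file is bookkeeping toward socket s23 and closes no item.
References: [Li1992] §3 Thm. 3.1; [GelbartRogawski1991] §3; [Liu2011] §2C (2-4) p. 863; [HarrisKudlaSweet1996] §6 (6.12)–(6.13); [BruhatTits1972] (4.4.4).
-/

set_option autoImplicit false
set_option linter.dupNamespace false

noncomputable section

open scoped Matrix
open NumberField IsDedekindDomain MeasureTheory
open Literature.NumberTheory.Automorphic Literature.NumberTheory.Automorphic.UnitaryGroup Literature.NumberTheory.GaloisRepresentations
open Literature.NumberTheory.GelbartRogawski1991 Literature.NumberTheory.GelbartRogawski1991.GRConstruction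
open Literature.NumberTheory.K2Lit Literature.NumberTheory.K2Lit.SiegelDoubled
open Summit.HodgeConjecture.HodgeConjecture.Cruxes.HLiu418.K2LiuUnramifiedDoublingHeckeIdentityInert (unramifiedDoublingHeckeIdentityInert)
open Summit.HodgeConjecture.HodgeConjecture.Cruxes.HLiu418.K2LiuDoublingZetaGL1Transport
open Summit.HodgeConjecture.HodgeConjecture.Cruxes.HLiu418.K2LiuDoublingZetaGL1LocalScalar
open Summit.HodgeConjecture.HodgeConjecture.Cruxes.HLiu418.K2LiuDoublingZetaGL1Docking
open Summit.HodgeConjecture.HodgeConjecture.Cruxes.HLiu418.K2LiuDoublingZetaGL1SplitIdentity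

namespace Summit.HodgeConjecture.HodgeConjecture.Cruxes.HLiu418.K2LiuDoublingZetaGL1InertIdentity

/-! ## §1 Generic transport, one generator -/

section Generic

variable {G G' : Type} [Group G] [Group G'] [TopologicalSpace G] [TopologicalSpace G']
  [MeasurableSpace G] [MeasurableSpace G'] [BorelSpace G] [BorelSpace G']
  {V : Type} [NormedAddCommGroup V] [NormedSpace ℂ V] [CompleteSpace V]

/-- **spherical Hecke eigen-data move forward along `β : G ≃ₜ* G'`** (one generator): if `β⁻¹(K') = K` and `u` is `K`-spherical for
`τ₀ : G → End V` along `![β⁻¹ x₁]`, then `u` is `K'`-spherical for `τ₀ ∘ β⁻¹` along `![x₁]` w.r.t. `ν.map β` (★ `isSphericalHeckeEigen_map_iff`).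
[cite: Li1992, §3 Thm. 3.1] -/
theorem isSphericalHeckeEigen_push₁ (β : G ≃ₜ* G') (ν : Measure G) (K : Subgroup G) (K' : Subgroup G')
    (hKK : ∀ u : G, β u ∈ K' ↔ u ∈ K) (x₁ : G') (τ₀ : G → V →L[ℂ] V) (u : V) (a₁ : ℂ)
    (h : IsSphericalHeckeEigen ν K ![β.symm x₁] τ₀ u ![a₁]) :
    IsSphericalHeckeEigen (ν.map β) K' ![x₁] (fun y => τ₀ (β.symm y)) u ![a₁] := by
  have hβm : Measurable β.toMulEquiv := (map_continuous β).measurable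
  have hβsm : Measurable β.toMulEquiv.symm := (map_continuous β.symm).measurable
  have hKmap : K.map β.toMulEquiv.toMonoidHom = K' := by
    ext y
    constructor
    · rintro ⟨u, hu, rfl⟩
      exact (hKK u).2 hu
    · intro hy
      refine ⟨β.symm y, (hKK _).1 ?_, β.apply_symm_apply y⟩
      rwa [β.apply_symm_apply]
  have hgen : (fun i => β.toMulEquiv (![β.symm x₁] i)) = ![x₁] := by
    funext i
    fin_cases i
    exact β.apply_symm_apply x₁
  have hτ : (fun g => (fun y => τ₀ (β.symm y)) (β.toMulEquiv g)) = τ₀ := funext fun g => congrArg τ₀ (β.symm_apply_apply g)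
  have key := (isSphericalHeckeEigen_map_iff β.toMulEquiv hβm hβsm ν K ![β.symm x₁] (fun y => τ₀ (β.symm y)) u ![a₁]).2
    (by rw [hτ]; exact h)
  rw [hKmap, hgen] at key
  exact key

end Generic

/-! ## §2 ★ #28i for an action of `U(diag dV)(L⁺_v)` on a discrete automorphic `P` of `U(H)` through `G(𝔸)` -/

set_option maxHeartbeats 1600000 in -- ★ #28i's statement (as ★ #28i itself)
/-- **★ #28i on `π_P` through a continuous multiplicative map `ψ : U(diag dV)(L⁺_v) → U(H)(𝔸)`**: at an inert unramified good place, for `w ∈ P`,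
`w ≠ 0`, spherical along the inert generator `t₁` with eigenvalue `![a₁]` for `y ↦ π_P(ψ y)`, there is `c` with `w` a doubling-Hecke eigenvector of
`(ν', Λ_{s,v} ∘ ι_v(·,1))` for that action AND ★ #28i's cleared closed form for `c`. [cite: Li1992, §3 Thm. 3.1] [cite: GelbartRogawski1991, §3]
[cite: HarrisKudlaSweet1996, §6 (6.12)–(6.13)] -/
theorem doublingEigen_of_action_inert
    (L : Type) [Field L] [NumberField L] [IsCMField L] {n : ℕ} (e : Fin 2 × Fin 1 ≃ Fin n) (H : Matrix (Fin 2) (Fin 2) L)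
    (dV : Fin 2 → L) (hdV : ∀ i, IsCMField.complexConj L (dV i) = dV i) (hdV0 : ∀ i, dV i ≠ 0)
    (dW : Fin 1 → L) (hdW : ∀ i, IsCMField.complexConj L (dW i) = dW i) (hdW0 : ∀ i, dW i ≠ 0)
    (μ : Measure (adelicGroupData (↥(maximalRealSubfield L)) L (IsCMField.complexConj L) 2 H).automorphicQuotient)
    [(adelicGroupData (↥(maximalRealSubfield L)) L (IsCMField.complexConj L) 2 H).IsAutomorphicMeasure μ]
    (v : HeightOneSpectrum (𝓞 (↥(maximalRealSubfield L))))
    (w : UnitaryGroup.PlacesOver L v) (hw : IsCMField.complexConj L • w.1 = w.1) (hv : Algebra.IsUnramifiedIn (𝓞 L) v.asIdeal)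
    (h2 : ∀ w' : UnitaryGroup.PlacesOver L v, ValuativeRel.valuation (w'.1.adicCompletion L) (2 : w'.1.adicCompletion L) = 1)
    (hdVw : ∀ (w' : UnitaryGroup.PlacesOver L v) (i : Fin 2),
      ValuativeRel.valuation (w'.1.adicCompletion L) (algebraMap L (w'.1.adicCompletion L) (dV i)) = 1)
    (hT : ∀ (w' : UnitaryGroup.PlacesOver L v) (i j : Fin n), ValuativeRel.valuation (w'.1.adicCompletion L)
      (algebraMap L (w'.1.adicCompletion L) (algebraMap (↥(maximalRealSubfield L)) L (gramR L e dV hdV dW hdW i j))) ≤ 1)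
    (hTinv : ∀ (w' : UnitaryGroup.PlacesOver L v) (i j : Fin n), ValuativeRel.valuation (w'.1.adicCompletion L)
      (algebraMap L (w'.1.adicCompletion L) (algebraMap (↥(maximalRealSubfield L)) L ((gramR L e dV hdV dW hdW)⁻¹ i j))) ≤ 1)
    (χ : HeckeCharacter L) (hχu : χ.IsUnitary) (hχ : ∀ w' : UnitaryGroup.PlacesOver L v, χ.IsUnramifiedAt w'.1)
    (s : ℂ) (hs : 0 < s.re)
    [MeasurableSpace (UnitaryGroup.localPi L (IsCMField.complexConj L) 2 (Matrix.diagonal dV) v)]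
    [BorelSpace (UnitaryGroup.localPi L (IsCMField.complexConj L) 2 (Matrix.diagonal dV) v)]
    (ν' : Measure (UnitaryGroup.localPi L (IsCMField.complexConj L) 2 (Matrix.diagonal dV) v)) [ν'.IsHaarMeasure]
    (hν'K : ν' (UnitaryGroup.localInt L (IsCMField.complexConj L) 2 (Matrix.diagonal dV) v :
        Set (UnitaryGroup.localPi L (IsCMField.complexConj L) 2 (Matrix.diagonal dV) v)) = 1)
    (ϖ : w.1.adicCompletion L) (hϖ : Valued.v ϖ = WithZero.exp (-1 : ℤ))
    (hϖσ : galAdicCompletionMap (L := L) (IsCMField.complexConj L) hw ϖ = ϖ)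
    (T : GL (Fin 2) (w.1.adicCompletion L)) (hTi : T ∈ glInt 2 (w.1.adicCompletion L))
    (hTJ : UnitaryGroup.placeForm (Matrix.diagonal dV) w.1 =
      formCongr (galAdicCompletionMap (L := L) (IsCMField.complexConj L) hw) T ((StdForm.antidiagonal 2).over (w.1.adicCompletion L)))
    (t₁ : UnitaryGroup.localPi L (IsCMField.complexConj L) 2 (Matrix.diagonal dV) v)
    (ht₁ : (((t₁ : UnitaryGroup.LocalGLPi L 2 v) w : GL (Fin 2) (w.1.adicCompletion L)) : Matrix (Fin 2) (Fin 2) (w.1.adicCompletion L)) =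
      ((T⁻¹ : GL (Fin 2) (w.1.adicCompletion L)) : Matrix (Fin 2) (Fin 2) (w.1.adicCompletion L)) * Matrix.diagonal ![ϖ, ϖ⁻¹] *
        (T : Matrix (Fin 2) (Fin 2) (w.1.adicCompletion L)))
    (P : DiscreteAutomorphicRep (adelicGroupData (↥(maximalRealSubfield L)) L (IsCMField.complexConj L) 2 H) μ)
    (wv : P.space.toSubmodule) (hw0 : wv ≠ 0) (a₁ : ℂ)
    (ψ : UnitaryGroup.localPi L (IsCMField.complexConj L) 2 (Matrix.diagonal dV) v →
      (adelicGroupData (↥(maximalRealSubfield L)) L (IsCMField.complexConj L) 2 H).Adelic)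
    (hψ1 : ψ 1 = 1) (hψmul : ∀ a b, ψ (a * b) = ψ a * ψ b) (hψc : Continuous ψ)
    (heig' : IsSphericalHeckeEigen ν' (UnitaryGroup.localInt L (IsCMField.complexConj L) 2 (Matrix.diagonal dV) v) ![t₁]
      (fun y => P.space.toContRep (ψ y)) wv ![a₁]) :
    ∃ c : ℂ,
      IsDoublingHeckeEigenvector ν' (fun y => LambdaLoc L e dV hdV dW hdW v χ s (iotaLeftLocPi L e dV hdV dW hdW v y))
        (fun y => P.space.toContRep (ψ y)) wv c ∧
      c * (1 - χ.valueAtUniformizer w.1 * (a₁ - (v.residueCard : ℂ) + 1) * (v.residueCard : ℂ) ^ (-(2 * s + 2)) +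
            χ.valueAtUniformizer w.1 ^ 2 * (v.residueCard : ℂ) ^ (-(4 * s + 2))) =
        (1 + χ.valueAtUniformizer w.1 * (v.residueCard : ℂ) ^ (-(2 * s + 1))) *
          (1 - χ.valueAtUniformizer w.1 * (v.residueCard : ℂ) ^ (-(2 * s + 2))) := by
  haveI : CompleteSpace P.space.toSubmodule := P.space.isClosed'.completeSpace_coe
  -- `ψ` as a monoid homomorphism and the action `τ = π_P ∘ ψ`
  set ψh : UnitaryGroup.localPi L (IsCMField.complexConj L) 2 (Matrix.diagonal dV) v →*
      (adelicGroupData (↥(maximalRealSubfield L)) L (IsCMField.complexConj L) 2 H).Adelic :=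
    { toFun := ψ, map_one' := hψ1, map_mul' := hψmul } with hψhdef
  set τ : UnitaryGroup.localPi L (IsCMField.complexConj L) 2 (Matrix.diagonal dV) v →* (P.space.toSubmodule →L[ℂ] P.space.toSubmodule) :=
    P.space.toContRep.toMonoidHom.comp ψh with hτdef
  have hτ : ∀ y, τ y = P.space.toContRep (ψ y) := fun _ => rfl
  have hτfun : (fun y => τ y) = fun y => P.space.toContRep (ψ y) := funext fun y => hτ y
  have hτb : ∀ y, ‖τ y‖ ≤ 1 := by
    intro y
    refine ContinuousLinearMap.opNorm_le_bound _ zero_le_one fun u => ?_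
    rw [one_mul, hτ, Submodule.coe_norm, ContRepresentation.ClosedSubrep.coe_toContRep_apply,
      (adelicGroupData (↥(maximalRealSubfield L)) L (IsCMField.complexConj L) 2 H).norm_rightRegular_apply μ, Submodule.coe_norm]
  have hτc : ∀ u : P.space.toSubmodule, Continuous fun y => τ y u := by
    intro u
    have hc : Continuous fun y : UnitaryGroup.localPi L (IsCMField.complexConj L) 2 (Matrix.diagonal dV) v =>
        (P.space.toSubmodule.subtype) (P.space.toContRep (ψ y) u) := by
      simp only [Submodule.subtype_apply, ContRepresentation.ClosedSubrep.coe_toContRep_apply]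
      exact (((adelicGroupData (↥(maximalRealSubfield L)) L (IsCMField.complexConj L) 2 H).isStronglyContinuous_rightRegular_holds μ)
        (u : (adelicGroupData (↥(maximalRealSubfield L)) L (IsCMField.complexConj L) 2 H).L2 μ)).comp hψc
    simp only [hτ]
    exact continuous_induced_rng.2 hc
  rw [← hτfun] at heig' ⊢
  obtain ⟨c, hEig, hId⟩ := unramifiedDoublingHeckeIdentityInert L e dV hdV hdV0 dW hdW hdW0 v w hw hv h2 hdVw hT hTinv χ hχu hχ s hs ν' hν'K
    ϖ hϖ hϖσ T hTi hTJ t₁ ht₁ τ hτc hτb wv hw0 a₁ heig'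
  exact ⟨c, hEig, hId⟩

/-! ## §3 The inert local identity -/

set_option maxHeartbeats 1600000 in -- two adelic unitary data + ★ #28i's closed form in the statement
/-- **ORGAN O3b-inert OF #34 — THE INERT LOCAL IDENTITY (E)_v FOR AN AUTOMORPHIC VECTOR OF `U(H)`, WITH ★ #28i's CLOSED FORM.**  s23's frame
(`H`, `dV`, `dW ≠ 0`, `t ≠ 0`, `g`, `hg`), an inert unramified good place `w ∣ v` with ★ #28i's frame `ϖ, T, t₁` (read on the `U(diag dV)` side), the
docking `β_v = localCongr g⁻¹` good at `v` (`β_v u ∈ K_{diag,v} ↔ u ∈ K_{H,v}`), `χ` unitary unramified above `v`, `0 < Re s`, a Haar `ν` on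
`U(H)(L⁺_v)` with `ν(K_{H,v}) = 1`; a discrete automorphic `P` of `U(H)`, `w ∈ P`, `w ≠ 0`, `w =ᵐ φ₁`, an `L²` class `φ₂ᴸ =ᵐ φ₂`; and `w` a
`K_{H,v}`-spherical Hecke eigenvector along `![β_v⁻¹ t₁]` with eigenvalue `![a₁]` for `π_P ∘ ι_v`.  THEN there is `c` with, for every `t ∈ U(H)(𝔸)`,
`localZeta ν (Λ_{s,v} ∘ ι_v(·,1) ∘ β_v) (g ↦ ⟨π(t · ι_v g)φ₁, φ₂⟩) = c · ⟨π(t)φ₁, φ₂⟩` — hypothesis (E) of ★ #29s at `v` — and ★ #28i's cleared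
identity for `c` at `a₁` verbatim. [cite: Li1992, §3 Thm. 3.1] [cite: GelbartRogawski1991, §3 pp. 455–459] [cite: HarrisKudlaSweet1996, §6 (6.12)–(6.13)]
[cite: BruhatTits1972, (4.4.4)] -/
theorem localIdentity_inert :
    ∀ (L : Type) [Field L] [NumberField L] [IsCMField L] {n : ℕ} (e : Fin 2 × Fin 1 ≃ Fin n) (H : Matrix (Fin 2) (Fin 2) L)
      (dV : Fin 2 → L) (hdV : ∀ i, IsCMField.complexConj L (dV i) = dV i) (_hdV0 : ∀ i, dV i ≠ 0)
      (dW : Fin 1 → L) (hdW : ∀ i, IsCMField.complexConj L (dW i) = dW i) (_hdW0 : ∀ i, dW i ≠ 0)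
      (t : L) (ht : t ≠ 0) (g : GL (Fin 2) L)
      (hg : formCongr ((IsCMField.complexConj L : L ≃ₐ[↥(maximalRealSubfield L)] L) : L →+* L) g (t • H) = Matrix.diagonal dV)
      (μ : Measure (adelicGroupData (↥(maximalRealSubfield L)) L (IsCMField.complexConj L) 2 H).automorphicQuotient)
      [(adelicGroupData (↥(maximalRealSubfield L)) L (IsCMField.complexConj L) 2 H).IsAutomorphicMeasure μ]
      (v : HeightOneSpectrum (𝓞 (↥(maximalRealSubfield L))))
      -- an INERT UNRAMIFIED place of good reduction (★ #28i's binders, on the `U(diag dV)` side)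
      (w : UnitaryGroup.PlacesOver L v) (_hw : IsCMField.complexConj L • w.1 = w.1) (_hv : Algebra.IsUnramifiedIn (𝓞 L) v.asIdeal)
      (_h2 : ∀ w' : UnitaryGroup.PlacesOver L v, ValuativeRel.valuation (w'.1.adicCompletion L) (2 : w'.1.adicCompletion L) = 1)
      (_hdVw : ∀ (w' : UnitaryGroup.PlacesOver L v) (i : Fin 2),
        ValuativeRel.valuation (w'.1.adicCompletion L) (algebraMap L (w'.1.adicCompletion L) (dV i)) = 1)
      (_hT : ∀ (w' : UnitaryGroup.PlacesOver L v) (i j : Fin n), ValuativeRel.valuation (w'.1.adicCompletion L)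
        (algebraMap L (w'.1.adicCompletion L) (algebraMap (↥(maximalRealSubfield L)) L (gramR L e dV hdV dW hdW i j))) ≤ 1)
      (_hTinv : ∀ (w' : UnitaryGroup.PlacesOver L v) (i j : Fin n), ValuativeRel.valuation (w'.1.adicCompletion L)
        (algebraMap L (w'.1.adicCompletion L) (algebraMap (↥(maximalRealSubfield L)) L ((gramR L e dV hdV dW hdW)⁻¹ i j))) ≤ 1)
      -- the docking is good at `v`
      (_hβK : ∀ u : UnitaryGroup.localPi L (IsCMField.complexConj L) 2 H v,
        localCongr L (IsCMField.complexConj L) g⁻¹ (inv_ne_zero ht) (formCongr_inv_diagonal L H dV t ht g hg) v u ∈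
            UnitaryGroup.localInt L (IsCMField.complexConj L) 2 (Matrix.diagonal dV) v ↔
          u ∈ UnitaryGroup.localInt L (IsCMField.complexConj L) 2 H v)
      (χ : HeckeCharacter L) (_hχu : χ.IsUnitary) (_hχ : ∀ w' : UnitaryGroup.PlacesOver L v, χ.IsUnramifiedAt w'.1)
      (s : ℂ) (_hs : 0 < s.re)
      [MeasurableSpace (UnitaryGroup.localPi L (IsCMField.complexConj L) 2 H v)]
      [BorelSpace (UnitaryGroup.localPi L (IsCMField.complexConj L) 2 H v)]
      (ν : Measure (UnitaryGroup.localPi L (IsCMField.complexConj L) 2 H v)) [ν.IsHaarMeasure]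
      (_hνK : ν (UnitaryGroup.localInt L (IsCMField.complexConj L) 2 H v :
          Set (UnitaryGroup.localPi L (IsCMField.complexConj L) 2 H v)) = 1)
      -- ★ #28i's inert frame: a `σ_w`-fixed uniformizer, an integral hyperbolic frame of the place form, the ONE Hecke generator
      (ϖ : w.1.adicCompletion L) (_hϖ : Valued.v ϖ = WithZero.exp (-1 : ℤ))
      (_hϖσ : galAdicCompletionMap (L := L) (IsCMField.complexConj L) _hw ϖ = ϖ)
      (T : GL (Fin 2) (w.1.adicCompletion L)) (_hTi : T ∈ glInt 2 (w.1.adicCompletion L))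
      (_hTJ : UnitaryGroup.placeForm (Matrix.diagonal dV) w.1 =
        formCongr (galAdicCompletionMap (L := L) (IsCMField.complexConj L) _hw) T ((StdForm.antidiagonal 2).over (w.1.adicCompletion L)))
      (t₁ : UnitaryGroup.localPi L (IsCMField.complexConj L) 2 (Matrix.diagonal dV) v)
      (_ht₁ : (((t₁ : UnitaryGroup.LocalGLPi L 2 v) w : GL (Fin 2) (w.1.adicCompletion L)) : Matrix (Fin 2) (Fin 2) (w.1.adicCompletion L)) =
        ((T⁻¹ : GL (Fin 2) (w.1.adicCompletion L)) : Matrix (Fin 2) (Fin 2) (w.1.adicCompletion L)) * Matrix.diagonal ![ϖ, ϖ⁻¹] *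
          (T : Matrix (Fin 2) (Fin 2) (w.1.adicCompletion L)))
      -- the automorphic vector and the two slots
      (P : DiscreteAutomorphicRep (adelicGroupData (↥(maximalRealSubfield L)) L (IsCMField.complexConj L) 2 H) μ)
      (wv : P.space.toSubmodule) (_hw0 : wv ≠ 0)
      (φ₂L : (adelicGroupData (↥(maximalRealSubfield L)) L (IsCMField.complexConj L) 2 H).L2 μ)
      (φ₁ φ₂ : (adelicGroupData (↥(maximalRealSubfield L)) L (IsCMField.complexConj L) 2 H).automorphicQuotient → ℂ)
      (_hw1 : (((wv : (adelicGroupData (↥(maximalRealSubfield L)) L (IsCMField.complexConj L) 2 H).L2 μ)) :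
          (adelicGroupData (↥(maximalRealSubfield L)) L (IsCMField.complexConj L) 2 H).automorphicQuotient → ℂ) =ᵐ[μ] φ₁)
      (_hφ₂ : ((φ₂L : (adelicGroupData (↥(maximalRealSubfield L)) L (IsCMField.complexConj L) 2 H).L2 μ) :
          (adelicGroupData (↥(maximalRealSubfield L)) L (IsCMField.complexConj L) 2 H).automorphicQuotient → ℂ) =ᵐ[μ] φ₂)
      -- the eigen-datum of `w` on the `U(H)` side along the docked generator
      (a₁ : ℂ)
      (_heig : IsSphericalHeckeEigen ν (UnitaryGroup.localInt L (IsCMField.complexConj L) 2 H v)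
        ![(localCongr L (IsCMField.complexConj L) g⁻¹ (inv_ne_zero ht) (formCongr_inv_diagonal L H dV t ht g hg) v).symm t₁]
        (fun g' => P.space.toContRep (UnitaryGroup.inclPlaceAdelic (↥(maximalRealSubfield L)) L (IsCMField.complexConj L) 2 H v g')) wv ![a₁]),
      ∃ c : ℂ,
        (∀ tt : (adelicGroupData (↥(maximalRealSubfield L)) L (IsCMField.complexConj L) 2 H).Adelic,
          localZeta ν
              (fun y => LambdaLoc L e dV hdV dW hdW v χ s
                (iotaLeftLocPi L e dV hdV dW hdW v
                  (localCongr L (IsCMField.complexConj L) g⁻¹ (inv_ne_zero ht) (formCongr_inv_diagonal L H dV t ht g hg) v y)))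
              (fun y => quotMatrixCoeff (adelicGroupData (↥(maximalRealSubfield L)) L (IsCMField.complexConj L) 2 H) μ φ₁ φ₂
                (tt * UnitaryGroup.inclPlaceAdelic (↥(maximalRealSubfield L)) L (IsCMField.complexConj L) 2 H v y)) =
            c * quotMatrixCoeff (adelicGroupData (↥(maximalRealSubfield L)) L (IsCMField.complexConj L) 2 H) μ φ₁ φ₂ tt) ∧
        c * (1 - χ.valueAtUniformizer w.1 * (a₁ - (v.residueCard : ℂ) + 1) * (v.residueCard : ℂ) ^ (-(2 * s + 2)) +
              χ.valueAtUniformizer w.1 ^ 2 * (v.residueCard : ℂ) ^ (-(4 * s + 2))) =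
          (1 + χ.valueAtUniformizer w.1 * (v.residueCard : ℂ) ^ (-(2 * s + 1))) *
            (1 - χ.valueAtUniformizer w.1 * (v.residueCard : ℂ) ^ (-(2 * s + 2))) := by
  intro L _ _ _ n e H dV hdV hdV0 dW hdW hdW0 t ht g hg μ _ v w hw hv h2 hdVw hT hTinv hβK χ hχu hχ s hs _ _ ν _ hνK ϖ hϖ hϖσ T hTi hTJ t₁ ht₁
    P wv hw0 φ₂L φ₁ φ₂ hw1 hφ₂ a₁ heig
  -- Borel structure on the `U(diag dV)` side (the transported measure `ν.map β` is Haar: Mathlib `ContinuousMulEquiv.isHaarMeasure_map`)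
  letI : MeasurableSpace (UnitaryGroup.localPi L (IsCMField.complexConj L) 2 (Matrix.diagonal dV) v) := borel _
  haveI : BorelSpace (UnitaryGroup.localPi L (IsCMField.complexConj L) 2 (Matrix.diagonal dV) v) := ⟨rfl⟩
  haveI : CompleteSpace P.space.toSubmodule := P.space.isClosed'.completeSpace_coe
  -- `(ν.map β)(K_{diag,v}) = ν(K_{H,v}) = 1`
  have hν'K : (ν.map (localCongr L (IsCMField.complexConj L) g⁻¹ (inv_ne_zero ht) (formCongr_inv_diagonal L H dV t ht g hg) v))
      (UnitaryGroup.localInt L (IsCMField.complexConj L) 2 (Matrix.diagonal dV) v :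
        Set (UnitaryGroup.localPi L (IsCMField.complexConj L) 2 (Matrix.diagonal dV) v)) = 1 :=
    (measure_map_eq_of_preimage (localCongr L (IsCMField.complexConj L) g⁻¹ (inv_ne_zero ht) (formCongr_inv_diagonal L H dV t ht g hg) v) ν _ _
      (UnitaryGroup.isOpen_localInt L (IsCMField.complexConj L) 2 (Matrix.diagonal dV) v) hβK).trans hνK
  -- `w`'s eigen-datum on the `U(diag dV)` side (§1)
  have heig' := isSphericalHeckeEigen_push₁ (localCongr L (IsCMField.complexConj L) g⁻¹ (inv_ne_zero ht) (formCongr_inv_diagonal L H dV t ht g hg) v) ν _ _ hβK t₁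
    (fun g' => P.space.toContRep ((UnitaryGroup.inclPlaceAdelic (↥(maximalRealSubfield L)) L (IsCMField.complexConj L) 2 H v) g')) wv a₁ heig
  -- ★ #28i for the action `y ↦ π_P(ι_v (β⁻¹ y))` (§2)
  obtain ⟨c, hEig, hId⟩ := doublingEigen_of_action_inert L e H dV hdV hdV0 dW hdW hdW0 μ v w hw hv h2 hdVw hT hTinv χ hχu hχ s hs
    (ν.map (localCongr L (IsCMField.complexConj L) g⁻¹ (inv_ne_zero ht) (formCongr_inv_diagonal L H dV t ht g hg) v)) hν'K ϖ hϖ hϖσ T hTi hTJ t₁ ht₁ P wv hw0 a₁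
    (fun y => (UnitaryGroup.inclPlaceAdelic (↥(maximalRealSubfield L)) L (IsCMField.complexConj L) 2 H v) ((localCongr L (IsCMField.complexConj L) g⁻¹ (inv_ne_zero ht) (formCongr_inv_diagonal L H dV t ht g hg) v).symm y))
    (by rw [map_one, map_one]) (fun a b => by rw [map_mul, map_mul])
    ((UnitaryGroup.continuous_inclPlaceAdelic (↥(maximalRealSubfield L)) L (IsCMField.complexConj L) 2 H v).comp (map_continuous (localCongr L (IsCMField.complexConj L) g⁻¹ (inv_ne_zero ht) (formCongr_inv_diagonal L H dV t ht g hg) v).symm))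
    heig'
  refine ⟨c, fun tt => ?_, hId⟩
  -- pull back along `β` (★ O3b §1) and read on matrix coefficients (★ LocalScalar)
  have hEigH := isDoublingHeckeEigenvector_pull (localCongr L (IsCMField.complexConj L) g⁻¹ (inv_ne_zero ht) (formCongr_inv_diagonal L H dV t ht g hg) v) ν _
    (fun g' => P.space.toContRep ((UnitaryGroup.inclPlaceAdelic (↥(maximalRealSubfield L)) L (IsCMField.complexConj L) 2 H v) g')) wv c hEig
  exact localScalar_of_isDoublingHeckeEigenvector (adelicGroupData (↥(maximalRealSubfield L)) L (IsCMField.complexConj L) 2 H) μ P.space wv φ₂L hw1 hφ₂ (UnitaryGroup.inclPlaceAdelic (↥(maximalRealSubfield L)) L (IsCMField.complexConj L) 2 H v) ν _ c hEigH tt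

end Summit.HodgeConjecture.HodgeConjecture.Cruxes.HLiu418.K2LiuDoublingZetaGL1InertIdentity

end
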